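import Mathlib.Topology.Algebra.OpenSubgroup
import Literature.IUT.HodgeTheaters.KappaCoricRatGaloisRestriction
import HarnessLib

/-!
# [IUTchI] Example 5.4 (iv), p. 149 — restriction data, file 4: ALGEBRAIC base change (`[L' : L]` algebraic,
# e.g. `F_mod ⊆ F`, `F ⊆ F̄`): `ι` is an ISOMORPHISM `Λ_L ≅ Λ_{L'}` and `ratHom` is the INCLUSION of
# `Gal(Λ/L'(t))` into `Gal(Λ/L(t))` (cell abc-iut, GAP B = G-L5t9g8-1, item GB-03; seat abc-iut-gapB-03-restrictionData)

S. Mochizuki, *Inter-universal Teichmüller theory I*, kurims manuscript (May 2020), Example 5.1 (i) p. 123: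
«`π₁(†𝒟^⊛) → G_{F_mod}`», «the absolute Galois group of the function field of `C_{F_mod}`» and Example 5.4 (iv)
p. 149 ([IUTchI] Ex 5.1 (i) p.123, Ex 5.4 (iv) p.149) [claim: Mochizuki2012, status: disputed] (D-0012 claim key;
elementary field theory at print's MODEL presentation; nothing disputed; no side on [IUTchIII] Cor. 3.12).

## Why (design (B), RULINGS #340 (A): the global base of record is `L := F`, with the label «print: `C_{F_mod}`;
## `[F : F_mod] < ∞` ⇒ an open subgroup of print's `π₁^{rat}(†𝒟^⊛)`»)

This file turns the subgroup half of that label into theorems, for ANY base change `φ : L →+* L'` along which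
`L'` is algebraic (`φ.IsIntegral`; e.g. `F_mod → F`, `F → F̄`, `K → K̄`):
* `isIntegral_ratFuncMapCoeffs` — then `L'(t)` is algebraic over `ψ(L(t))` (`ψ = ratFuncMapCoeffs φ`);
* `iota_surjective_of_isIntegral` / `iota_bijective_of_isIntegral` / `iotaRingEquiv` — `ι : Λ_L → Λ_{L'}` is onto,
  i.e. an isomorphism `Λ_L ≅ Λ_{L'}` («`Λ_{F_mod} = Λ_F = Λ_{F̄}`»: ONE algebraic closure of `F_mod(t)`);
* `ratHom_injective_of_isIntegral` — `ratHom φ : Gal(Λ_{L'}/L'(t)) → Gal(Λ_L/L(t))` is INJECTIVE, and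
  `mem_range_ratHom_iff_of_isIntegral` — its image is exactly the subgroup of `Gal(Λ_L/L(t))` fixing
  `ι⁻¹(L'(t))` pointwise (so `Gal(Λ_F/F(t)) ↪ Gal(Λ_{F_mod}/F_mod(t))` is the subgroup `Gal(Λ/F(t))`).
* `isOpen_range_ratHom` — for a FINITE extension `[L' : L] < ∞` (`[Algebra L L'] [Module.Finite L L']`, `φ :=
  algebraMap L L'`) that image is OPEN: it contains the fixing subgroup of the finite-dimensional
  `L(t)(ι⁻¹ b₁, …, ι⁻¹ b_n)` for an `L`-basis `b` of `L'` — the label's «`G_F ⊆ G_{F_mod}` open» as a theorem.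

PROOF/CONSTRUCTION companion: one `def` (`iotaRingEquiv`), theorems; no instance, no notation, no new Prop fact,
no `sorry`; count-neutral; nothing here asserts that abc is proved or refuted.
-/

namespace Literature.IUT.HodgeTheaters

namespace RatBaseChange

open Polynomial Literature.FieldTheory.FunctionField
open scoped Polynomial

universe u v

variable {L : Type u} {L' : Type v} [Field L] [Field L'] (φ : L →+* L')

/-! ### `L'(t)` is algebraic over `L(t)` when `L'` is algebraic over `L` -/

/-- **If `L'` is algebraic over `φ(L)` then `L'(t)` is algebraic (= integral) over `ψ(L(t))`**: constants
`c ∈ L'` satisfy their `L`-equations read in `L(t)`, `t = ψ(t)`, polynomials are sums of products of these, and a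
rational function is a quotient of two polynomials (integral elements over a FIELD are closed under inverses).
([IUTchI] Ex 5.1 (i) p.123) [claim: Mochizuki2012, status: disputed] -/
theorem isIntegral_ratFuncMapCoeffs (hφ : φ.IsIntegral) : (ratFuncMapCoeffs φ).IsIntegral := by
  letI : Algebra (RatFunc L) (RatFunc L') := (ratFuncMapCoeffs φ).toAlgebra
  have hC : ∀ c : L', IsIntegral (RatFunc L) (RatFunc.C c) := by
    intro c
    obtain ⟨p, hp, hpc⟩ := hφ c
    refine ⟨p.map (algebraMap L (RatFunc L)), hp.map _, ?_⟩
    have hcomp : (algebraMap (RatFunc L) (RatFunc L')).comp (algebraMap L (RatFunc L)) = RatFunc.C.comp φ :=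
      ratFuncMapCoeffs_comp_C φ
    rw [Polynomial.eval₂_map, hcomp, ← Polynomial.hom_eval₂, hpc, map_zero]
  have hX : IsIntegral (RatFunc L) (RatFunc.X : RatFunc L') := by
    have h := isIntegral_algebraMap (R := RatFunc L) (A := RatFunc L') (x := RatFunc.X)
    rwa [show algebraMap (RatFunc L) (RatFunc L') RatFunc.X = RatFunc.X from ratFuncMapCoeffs_X φ] at h
  have hpoly : ∀ p : L'[X], IsIntegral (RatFunc L) (algebraMap L'[X] (RatFunc L') p) := by
    intro p
    induction p using Polynomial.induction_on with
    | C c => simpa using hC c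
    | add p q hp hq => simpa using hp.add hq
    | monomial n c h =>
      rw [pow_succ, ← mul_assoc, map_mul, RatFunc.algebraMap_X]
      exact h.mul hX
  intro f
  show IsIntegral (RatFunc L) f
  rw [← RatFunc.num_div_denom f, div_eq_mul_inv]
  exact (hpoly f.num).mul (hpoly f.denom).inv

/-! ### `ι` is an isomorphism `Λ_L ≅ Λ_{L'}` -/

/-- **`ι` is onto when `L'` is algebraic over `L`**: every `y ∈ Λ_{L'}` is algebraic over `L'(t)`, hence over
`L(t)` (transitivity through `isIntegral_ratFuncMapCoeffs`), hence lies in the image of `ι` (= the relative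
algebraic closure, `mem_range_iota_iff_mem_algebraicClosure`).
([IUTchI] Ex 5.1 (i) p.123) [claim: Mochizuki2012, status: disputed] -/
theorem iota_surjective_of_isIntegral (hφ : φ.IsIntegral) : Function.Surjective (iota φ) := by
  intro y
  have hint : ((algebraMap (RatFunc L') (AlgebraicClosure (RatFunc L'))).comp
      (ratFuncMapCoeffs φ)).IsIntegral :=
    RingHom.IsIntegral.trans _ _ (isIntegral_ratFuncMapCoeffs φ hφ)
      (fun z => Algebra.IsIntegral.isIntegral (R := RatFunc L') z)
  letI := baseAlgebra φ
  have hy : IsIntegral (RatFunc L) y := hint y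
  obtain ⟨x, hx⟩ := (mem_range_iota_iff_mem_algebraicClosure φ y).mpr
    (mem_algebraicClosure_iff.mpr hy.isAlgebraic)
  exact ⟨x, hx⟩

/-- `ι` is a bijection `Λ_L → Λ_{L'}` for algebraic `L'/L`. ([IUTchI] Ex 5.1 (i) p.123)
[claim: Mochizuki2012, status: disputed] -/
theorem iota_bijective_of_isIntegral (hφ : φ.IsIntegral) : Function.Bijective (iota φ) :=
  ⟨iota_injective φ, iota_surjective_of_isIntegral φ hφ⟩

/-- **`Λ_L ≅ Λ_{L'}`** for algebraic `L'/L` — `ι` as a ring isomorphism («`Λ_{F_mod} = Λ_F`»: both are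
algebraic closures of `F_mod(t)`). ([IUTchI] Ex 5.1 (i) p.123) [claim: Mochizuki2012, status: disputed] -/
noncomputable def iotaRingEquiv (hφ : φ.IsIntegral) :
    AlgebraicClosure (RatFunc L) ≃+* AlgebraicClosure (RatFunc L') :=
  RingEquiv.ofBijective (iota φ) (iota_bijective_of_isIntegral φ hφ)

/-- `iotaRingEquiv` is `ι` on elements. ([IUTchI] Ex 5.1 (i) p.123) [claim: Mochizuki2012, status: disputed] -/
@[simp] theorem iotaRingEquiv_apply (hφ : φ.IsIntegral) (x : AlgebraicClosure (RatFunc L)) :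
    iotaRingEquiv φ hφ x = iota φ x :=
  rfl

/-- `ι (ι⁻¹ y) = y`. ([IUTchI] Ex 5.1 (i) p.123) [claim: Mochizuki2012, status: disputed] -/
@[simp] theorem iota_iotaRingEquiv_symm_apply (hφ : φ.IsIntegral) (y : AlgebraicClosure (RatFunc L')) :
    iota φ ((iotaRingEquiv φ hφ).symm y) = y :=
  (iotaRingEquiv φ hφ).apply_symm_apply y

/-! ### `ratHom` is the inclusion `Gal(Λ/L'(t)) ↪ Gal(Λ/L(t))` -/

/-- **`ratHom φ` is INJECTIVE for algebraic `L'/L`**: `σ` is recovered from `ratHom σ` through the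
isomorphism `ι` (`σ (ι x) = ι (ratHom σ x)` and `ι` is onto). ([IUTchI] Ex 5.1 (i) p.123)
[claim: Mochizuki2012, status: disputed] -/
theorem ratHom_injective_of_isIntegral (hφ : φ.IsIntegral) : Function.Injective (ratHom φ) := by
  intro σ τ h
  refine AlgEquiv.ext fun y => ?_
  obtain ⟨x, rfl⟩ := iota_surjective_of_isIntegral φ hφ y
  rw [← iota_ratHom_apply, ← iota_ratHom_apply, h]

/-- For `τ ∈ Gal(Λ_L/L(t))` fixing `ι⁻¹(L'(t))` pointwise, **the `L'(t)`-automorphism `ι ∘ τ ∘ ι⁻¹` of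
`Λ_{L'}`** (algebraic `L'/L`). ([IUTchI] Ex 5.1 (i) p.123) [claim: Mochizuki2012, status: disputed] -/
noncomputable def liftOfFixed (hφ : φ.IsIntegral)
    (τ : AlgebraicClosure (RatFunc L) ≃ₐ[RatFunc L] AlgebraicClosure (RatFunc L))
    (hτ : ∀ g : RatFunc L', τ ((iotaRingEquiv φ hφ).symm (algebraMap (RatFunc L') _ g)) =
      (iotaRingEquiv φ hφ).symm (algebraMap (RatFunc L') _ g)) :
    AlgebraicClosure (RatFunc L') ≃ₐ[RatFunc L'] AlgebraicClosure (RatFunc L') :=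
  AlgEquiv.ofRingEquiv (f := ((iotaRingEquiv φ hφ).symm.trans τ.toRingEquiv).trans (iotaRingEquiv φ hφ))
    fun g => by simp [hτ g]

/-- **The image of `ratHom φ` is EXACTLY the subgroup of `Gal(Λ_L/L(t))` fixing `ι⁻¹(L'(t))` pointwise**
(algebraic `L'/L`): `Gal(Λ_F/F(t)) ↪ Gal(Λ_{F_mod}/F_mod(t))` has image `Gal(Λ/F(t))`.
([IUTchI] Ex 5.1 (i) p.123) [claim: Mochizuki2012, status: disputed] -/
theorem mem_range_ratHom_iff_of_isIntegral (hφ : φ.IsIntegral)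
    (τ : AlgebraicClosure (RatFunc L) ≃ₐ[RatFunc L] AlgebraicClosure (RatFunc L)) :
    τ ∈ Set.range (ratHom φ) ↔ ∀ g : RatFunc L',
      τ ((iotaRingEquiv φ hφ).symm (algebraMap (RatFunc L') _ g)) =
        (iotaRingEquiv φ hφ).symm (algebraMap (RatFunc L') _ g) := by
  constructor
  · rintro ⟨σ, rfl⟩ g
    apply iota_injective φ
    rw [iota_ratHom_apply, iota_iotaRingEquiv_symm_apply, AlgEquiv.commutes]
  · intro hτ
    refine ⟨liftOfFixed φ hφ τ hτ, (eq_ratHom_of_forall_iota φ _ τ fun x => ?_).symm⟩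
    change iota φ (τ x) = iotaRingEquiv φ hφ (τ ((iotaRingEquiv φ hφ).symm (iota φ x)))
    rw [iotaRingEquiv_apply, ← iotaRingEquiv_apply φ hφ x, RingEquiv.symm_apply_apply]

/-! ### Finite `[L' : L]`: the image of `ratHom` is an OPEN subgroup -/

section Finite

variable {L L' : Type*} [Field L] [Field L'] [Algebra L L'] [Module.Finite L L']

/-- Over a field, a finite extension is integral (for `φ := algebraMap L L'`).
([IUTchI] Ex 5.1 (i) p.123) [claim: Mochizuki2012, status: disputed] -/
theorem isIntegral_algebraMap_of_finite : (algebraMap L L').IsIntegral :=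
  fun x => Algebra.IsIntegral.isIntegral x

/-- **`G_{L'}^{rat} ↪ G_L^{rat}` has OPEN image when `[L' : L] < ∞`** (`φ := algebraMap L L'`; e.g. `F_mod ⊆ F`):
for an `L`-basis `b₁, …, b_n` of `L'`, every `τ ∈ Gal(Λ_L/L(t))` fixing the finite-dimensional intermediate field
`L(t)(ι⁻¹ b₁, …, ι⁻¹ b_n)` fixes `ι⁻¹(L'(t))` pointwise (constants are `L`-combinations of the `bᵢ`, `t` is fixed,
and the fixed elements form a subfield), hence lies in the image (`mem_range_ratHom_iff_of_isIntegral`); so the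
image contains an open subgroup and is open.  This is the «open subgroup» clause of the design-(B) label
(`Gal(Λ_F/F(t)) ⊆ Gal(Λ_{F_mod}/F_mod(t))` open, `[F : F_mod] < ∞`).
([IUTchI] Ex 5.1 (i) p.123) [claim: Mochizuki2012, status: disputed] -/
theorem isOpen_range_ratHom : IsOpen (Set.range (ratHom (algebraMap L L'))) := by
  classical
  set φ : L →+* L' := algebraMap L L' with hφdef
  have hφ : φ.IsIntegral := isIntegral_algebraMap_of_finite
  -- `e := ι⁻¹ ∘ (L'(t) ↪ Λ_{L'}) : L'(t) → Λ_L`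
  set e : RatFunc L' →+* AlgebraicClosure (RatFunc L) :=
    (iotaRingEquiv φ hφ).symm.toRingHom.comp (algebraMap (RatFunc L') (AlgebraicClosure (RatFunc L'))) with he
  have he_apply : ∀ g, e g = (iotaRingEquiv φ hφ).symm (algebraMap (RatFunc L') _ g) := fun _ => rfl
  -- the finite-dimensional intermediate field generated by `ι⁻¹` of an `L`-basis of `L'`
  let b := Module.finBasis L L'
  let T : Set (AlgebraicClosure (RatFunc L)) := Set.range fun i => e (RatFunc.C (b i))
  haveI : Finite T := (Set.finite_range _).to_subtype
  have hT : ∀ y ∈ T, IsIntegral (RatFunc L) y := fun y _ => Algebra.IsIntegral.isIntegral y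
  haveI := IntermediateField.finiteDimensional_adjoin (K := RatFunc L) hT
  set M := IntermediateField.adjoin (RatFunc L) T with hM
  -- the image contains `Fix(M)`
  have hsub : (M.fixingSubgroup : Set _) ⊆ Set.range (ratHom φ) := by
    intro τ hτ
    rw [SetLike.mem_coe, IntermediateField.mem_fixingSubgroup_iff] at hτ
    rw [mem_range_ratHom_iff_of_isIntegral φ hφ]
    -- the subfield of `L'(t)` on which `τ ∘ e = e`
    let S : Subfield (RatFunc L') := ((τ : AlgebraicClosure (RatFunc L) →+* _).comp e).eqLocusField e
    have hS : ∀ g, g ∈ S ↔ τ (e g) = e g := fun g => Iff.rfl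
    -- `ψ(L(t)) ⊆ S`
    have hψ : ∀ g₀ : RatFunc L, ratFuncMapCoeffs φ g₀ ∈ S := by
      intro g₀
      rw [hS, he_apply, ← iota_algebraMap, ← iotaRingEquiv_apply φ hφ, RingEquiv.symm_apply_apply,
        AlgEquiv.commutes]
    -- the basis constants and `t` are in `S`
    have hb : ∀ i, RatFunc.C (b i) ∈ S := fun i =>
      (hS _).mpr (hτ _ (IntermediateField.subset_adjoin _ _ ⟨i, rfl⟩))
    have hX : (RatFunc.X : RatFunc L') ∈ S := by
      simpa only [ratFuncMapCoeffs_X] using hψ RatFunc.X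
    -- all constants are in `S`
    have hC : ∀ c : L', RatFunc.C c ∈ S := by
      intro c
      rw [← b.sum_repr c, map_sum]
      refine S.sum_mem fun i _ => ?_
      rw [Algebra.smul_def, map_mul, ← hφdef, ← ratFuncMapCoeffs_C]
      exact S.mul_mem (hψ _) (hb i)
    -- all polynomials, then all rational functions, are in `S`
    have hpoly : ∀ p : L'[X], algebraMap L'[X] (RatFunc L') p ∈ S := by
      intro p
      induction p using Polynomial.induction_on with
      | C c => simpa using hC c
      | add p q hp hq => simpa using S.add_mem hp hq
      | monomial n c h =>
        rw [pow_succ, ← mul_assoc, map_mul, RatFunc.algebraMap_X]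
        exact S.mul_mem h hX
    intro g
    rw [← he_apply, ← hS, ← RatFunc.num_div_denom g]
    exact S.div_mem (hpoly g.num) (hpoly g.denom)
  have hrange : Set.range (ratHom φ) = ((ratHomMonoidHom φ).range : Set _) := by
    ext τ
    simp
  rw [hrange] at hsub ⊢
  exact Subgroup.isOpen_mono (H₁ := M.fixingSubgroup) (fun τ hτ => hsub hτ) M.fixingSubgroup_isOpen

end Finite

end RatBaseChange

end Literature.IUT.HodgeTheaters
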